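import Summits.ResolutionOfSingularities.ResolutionOfSingularities.Theorems.WeightedInvariantHypersurfaceLocalGameEFT4SDimLE
import Summits.ResolutionOfSingularities.ResolutionOfSingularities.Theorems.WeightedInvariantP3tDrop
import HarnessLib

/-!
# (open″)≤3 for the pair of record `(ι₃ᵗ, J₃ᵗ) = (Iota3.iotaFlatT, Iota3.jFlatT)` — DEFINITIONS for the regime assembly: the
# literal ∃-body at one model position, and the two INPUT shapes of the assembly (TIE-FREE along a height-two stratum; the
# POINT bodies at dimension-3 point positions, keyed by `(ε, τ)`) (door `HypersurfaceCentreConstruction`,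
# stmt-ResolutionOfSingularities-19897; P3 rung clause h8 `JOpenPresentationForallSingLE 3 p Iota3.iotaFlatT Iota3.jFlatT`;
# DEAL (o52) SPLIT of res-L1-w43-plan-1 2026-08-27T15:54:33Z, part (o52-asm), hand res-D-brk-1)

Topic: `Summits/ResolutionOfSingularities/ResolutionOfSingularities/Theorems`. DEFINITIONS posited by the route `WeightedInvariant`
for the door item `HypersurfaceCentreConstruction` (`--supports stmt-ResolutionOfSingularities-19897`) — objects OF THE LINE (names
for the pieces of ONE clause of a conjecture-grade rung), not cited statements; plus `Iff.rfl`-level seams.  Nothing is asserted.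

* `JOpenLE3.JOpenBodyLE3 ι J A 𝔪 F` — the literal ∃-body of `JOpenPresentationForallSingLE 3 p ι J` (res-type-061, p522114) at ONE
  model position `(A, 𝔪, F)`: `h ∉ 𝔪`, a positively weighted system `(U, W)` in `A` with independent differentials at `A_𝔪`, and
  at every prime `𝔮 ∌ h` of local dimension `≤ 3` the stratum iff for `ι` and the presentation of `J` by `(U, W)`.  The clause is
  «every model position of a regular `A_𝔪` of dimension `≤ 3` with `0 ≠ F ∈ 𝔪² A_𝔪` has the body»
  (`jOpenPresentationForallSingLE_three_iff`).
* `JOpenLE3.TieFreeAlongCurveLE3 p` — INPUT (T) of the assembly, the shape the CURVE body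
  (`JOpenLE3.jOpenPresentationLE_body_curve`, res-D-brk-1) consumes: at a model position `(A, 𝔪, F)` (`A_𝔪` regular of dimension
  `≤ 3`, `0 ≠ F ∈ 𝔪² A_𝔪`) with a prime `𝔭 ≤ 𝔪`, `dim A_𝔭 = 2`, such that the equimultiple locus of `A_𝔪` is `V(𝔭 A_𝔪)` and
  `A_𝔪` is not a tie position, SOME basic open `D(h) ∋ 𝔪` contains no prime `𝔮 ⊇ 𝔭` of local dimension `≤ 3` at which `F` is a
  tie position (res-type-092's `Iota3.IsTiePosition`).  NECESSARY for the clause as typed (a tie prime `𝔮 ⊋ 𝔭` near `𝔪` has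
  `τ = 1 ≠ 0 = τ(𝔪)` on `V(U)`); at the closed points of a smooth threefold it is res-type-047's FINITENESS OF TIE POINTS
  ((c8τ), p540078 ff.); at non-closed model primes (the orbit-generic points of the registrar's RULING #8) it is the same statement
  for the height-one primes of `A ⧸ 𝔭` near `𝔪 ⧸ 𝔭` — NOT in the tree, and for an arbitrary non-closed `𝔪` of a `≥ 4`-dimensional
  `A` not expected without equivariance; the registrar keys it.
* `JOpenLE3.PointBodyLE3 p e t` — INPUT (P_{e,t}) of the assembly: the body at every model position of dimension EXACTLY `3` whose
  top `(ν ; ε ; τ)`-stratum is the closed point (`topStratumPrime iotaOrdEpsTau (A_𝔪) F = 𝔪 A_𝔪`) with `ε = e`, `τ = t`: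
  `(0, 0)` ISOLATED (J₃ᵗ = `jSigmaPt`; (o52-Bε0), res-type-057 / res-type-073-successor), `(0, 1)` TIE (J₃ᵗ = `jSigmaPt`),
  `(1, 0)` CROSSING (J₃ᵗ = `jContact`; (o52-Bε1)); `(1, 1)` is vacuous (`pointBodyLE3_one_one`, res-type-013's
  `iotaTau_eq_zero_of_iotaEps_eq_one`).

[OURS · L1 W4.3 · (o52-asm) · candidates; conjecture-grade design objects; nothing here asserts anything about Hironaka's problem; NOT a
statement of the manuscript under review (Hironaka 2017, [claim: Hironaka2017, status: under-review]); AI typing, weaker than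
expert review.]

## References

* res-L1-w43-plan-1, IOTA3-DESIGN v1.3 §8.4 (regime table) and DEAL (o52) SPLIT, HOME/STATUS 2026-08-27T15:54:33Z (OURS, AI planning).
* V. Cossart, U. Jannsen, S. Saito, *Desingularization: invariants and strategy*, LNM 2270 (2020), Ch. 2 (strata of local
  invariants on excellent schemes). [CossartJannsenSaito2020]
-/

noncomputable section

open IsLocalRing Literature.AlgebraicGeometry.Resolution
open Summit.ResolutionOfSingularities.ResolutionOfSingularities.Cruxes.HypersurfaceCentreConstruction.LocalEngine
open Summit.ResolutionOfSingularities.ResolutionOfSingularities.Cruxes.HypersurfaceCentreConstruction.LocalEngine.Iota3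

set_option linter.dupNamespace false -- mandated namespace of this single-conjunct summit

namespace Summit.ResolutionOfSingularities.ResolutionOfSingularities.Theorems

namespace JOpenLE3

open ContactCylinder

/-! ## The literal body at one model position -/

/-- [OURS · (o52-asm)] **The ∃-body of `JOpenPresentationForallSingLE 3 p ι J` at the model position `(A, 𝔪, F)`** (verbatim:
`h ∉ 𝔪`; `N`, `U : Fin N → A`, positive weights `W`; `U` in `𝔪 A_𝔪` with independent differentials; at every prime `𝔮 ∌ h` with
`dim A_𝔮 ≤ 3` the stratum iff `(∀ i, U i ∈ 𝔮) ↔ (F ∈ 𝔪_{A_𝔮}² ∧ ι (A_𝔮) F = ι (A_𝔪) F)` and the presentation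
`(∀ i, U i ∈ 𝔮) → ∀ m, J (A_𝔮) F m = (U; W)_m A_𝔮`).  A predicate of the line, not a cited statement. -/
def JOpenBodyLE3 (ι : (R : Type) → [CommRing R] → R → Ordinal.{0}) (J : (R : Type) → [CommRing R] → R → ℕ → Ideal R)
    (A : Type) [CommRing A] (𝔪 : Ideal A) [𝔪.IsPrime] (F : A) : Prop :=
  ∃ h : A, h ∉ 𝔪 ∧ ∃ (N : ℕ) (U : Fin N → A) (W : Fin N → ℕ), (∀ i, 0 < W i) ∧
    (∃ hU : ∀ i, algebraMap A (Localization.AtPrime 𝔪) (U i) ∈ maximalIdeal (Localization.AtPrime 𝔪),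
      LinearIndependent (ResidueField (Localization.AtPrime 𝔪))
        (fun i => ((maximalIdeal (Localization.AtPrime 𝔪)).toCotangent ⟨_, hU i⟩ :
          CotangentSpace (Localization.AtPrime 𝔪)))) ∧
    ∀ (𝔮 : Ideal A) [𝔮.IsPrime], h ∉ 𝔮 → ringKrullDim (Localization.AtPrime 𝔮) ≤ (3 : ℕ) →
      ((∀ i, U i ∈ 𝔮) ↔
        (algebraMap A (Localization.AtPrime 𝔮) F ∈ (maximalIdeal (Localization.AtPrime 𝔮)) ^ 2 ∧
          ι (Localization.AtPrime 𝔮) (algebraMap A (Localization.AtPrime 𝔮) F) =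
            ι (Localization.AtPrime 𝔪) (algebraMap A (Localization.AtPrime 𝔪) F))) ∧
      ((∀ i, U i ∈ 𝔮) → ∀ m : ℕ,
        J (Localization.AtPrime 𝔮) (algebraMap A (Localization.AtPrime 𝔮) F) m =
          (weightedMonomialIdeal U W m).map (algebraMap A (Localization.AtPrime 𝔮)))

/-- `JOpenPresentationForallSingLE 3 p ι J` IS «the body at every model position of a regular `A_𝔪` of dimension `≤ 3` with
`0 ≠ F ∈ 𝔪² A_𝔪`» (by `Iff.rfl`). [OURS · seam · (o52-asm)] -/
theorem jOpenPresentationForallSingLE_three_iff (p : ℕ) (ι : (R : Type) → [CommRing R] → R → Ordinal.{0})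
    (J : (R : Type) → [CommRing R] → R → ℕ → Ideal R) :
    JOpenPresentationForallSingLE 3 p ι J ↔
      ∀ (k₀ : Type) [Field k₀] [CharP k₀ p] [PerfectField k₀]
        (A : Type) [CommRing A] [Algebra k₀ A] [Algebra.FiniteType k₀ A] (𝔪 : Ideal A) [𝔪.IsPrime] (F : A),
        IsRegularLocalRing (Localization.AtPrime 𝔪) →
        ringKrullDim (Localization.AtPrime 𝔪) ≤ (3 : ℕ) →
        algebraMap A (Localization.AtPrime 𝔪) F ≠ 0 →
        algebraMap A (Localization.AtPrime 𝔪) F ∈ (maximalIdeal (Localization.AtPrime 𝔪)) ^ 2 →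
        JOpenBodyLE3 ι J A 𝔪 F :=
  Iff.rfl

/-! ## The two input shapes of the regime assembly -/

/-- [OURS · (o52-asm) · INPUT (T)] **TIE-FREENESS ALONG A HEIGHT-TWO STRATUM, dimension `≤ 3`.**  At a model position `(A, 𝔪, F)`
over a perfect field of characteristic `p` (`A` of finite type, `A_𝔪` regular of dimension `≤ 3`, `0 ≠ F ∈ 𝔪² A_𝔪`) with a prime
`𝔭 ≤ 𝔪`, `dim A_𝔭 = 2`, such that the equimultiple locus of `A_𝔪` is `V(𝔭 A_𝔪)` and `(A_𝔪, F)` is not a tie position: some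
`h ∉ 𝔪` such that no prime `𝔮 ⊇ 𝔭` with `h ∉ 𝔮` and `dim A_𝔮 ≤ 3` is a tie position.  The hypothesis `hτ` of
`JOpenLE3.jOpenPresentationLE_body_curve`; a candidate input of the line (see the module docstring for its status), not a cited
statement. -/
def TieFreeAlongCurveLE3 (p : ℕ) : Prop :=
  ∀ (k₀ : Type) [Field k₀] [CharP k₀ p] [PerfectField k₀]
    (A : Type) [CommRing A] [Algebra k₀ A] [Algebra.FiniteType k₀ A] (𝔪 : Ideal A) [𝔪.IsPrime] (F : A)
    (𝔭 : Ideal A) [𝔭.IsPrime], 𝔭 ≤ 𝔪 →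
    IsRegularLocalRing (Localization.AtPrime 𝔪) →
    ringKrullDim (Localization.AtPrime 𝔪) ≤ (3 : ℕ) →
    algebraMap A (Localization.AtPrime 𝔪) F ≠ 0 →
    algebraMap A (Localization.AtPrime 𝔪) F ∈ (maximalIdeal (Localization.AtPrime 𝔪)) ^ 2 →
    ringKrullDim (Localization.AtPrime 𝔭) = (2 : ℕ) →
    topStratum iotaOrd (Localization.AtPrime 𝔪) (algebraMap A (Localization.AtPrime 𝔪) F) =
      {𝔮 | 𝔭.map (algebraMap A (Localization.AtPrime 𝔪)) ≤ 𝔮.asIdeal} →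
    ¬ IsTiePosition (Localization.AtPrime 𝔪) (algebraMap A (Localization.AtPrime 𝔪) F) →
    ∃ h : A, h ∉ 𝔪 ∧ ∀ (𝔮 : Ideal A) [𝔮.IsPrime], h ∉ 𝔮 → 𝔭 ≤ 𝔮 → ringKrullDim (Localization.AtPrime 𝔮) ≤ (3 : ℕ) →
      ¬ IsTiePosition (Localization.AtPrime 𝔮) (algebraMap A (Localization.AtPrime 𝔮) F)

/-- [OURS · (o52-asm) · INPUT (P_{e,t})] **THE POINT BODIES, dimension exactly `3`, keyed by `(ε, τ) = (e, t)`.**  At every model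
position `(A, 𝔪, F)` over a perfect field of characteristic `p` with `A_𝔪` regular of dimension `3`, `0 ≠ F ∈ 𝔪² A_𝔪`, whose top
`(ν ; ε ; τ)`-stratum is the closed point (`topStratumPrime iotaOrdEpsTau (A_𝔪) F = 𝔪 A_𝔪`), with `iotaEps (A_𝔪) F = e` and
`iotaTau (A_𝔪) F = t`: the body `JOpenBodyLE3 iotaFlatT jFlatT A 𝔪 F`.  `(0, 0)` = ISOLATED, `(0, 1)` = TIE, `(1, 0)` = CROSSING;
`(1, 1)` is vacuous.  A candidate input of the line, not a cited statement. -/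
def PointBodyLE3 (p : ℕ) (e t : Ordinal.{0}) : Prop :=
  ∀ (k₀ : Type) [Field k₀] [CharP k₀ p] [PerfectField k₀]
    (A : Type) [CommRing A] [Algebra k₀ A] [Algebra.FiniteType k₀ A] (𝔪 : Ideal A) [𝔪.IsPrime] (F : A),
    IsRegularLocalRing (Localization.AtPrime 𝔪) →
    ringKrullDim (Localization.AtPrime 𝔪) = (3 : ℕ) →
    algebraMap A (Localization.AtPrime 𝔪) F ≠ 0 →
    algebraMap A (Localization.AtPrime 𝔪) F ∈ (maximalIdeal (Localization.AtPrime 𝔪)) ^ 2 →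
    topStratumPrime iotaOrdEpsTau (Localization.AtPrime 𝔪) (algebraMap A (Localization.AtPrime 𝔪) F) =
      maximalIdeal (Localization.AtPrime 𝔪) →
    iotaEps (Localization.AtPrime 𝔪) (algebraMap A (Localization.AtPrime 𝔪) F) = e →
    iotaTau (Localization.AtPrime 𝔪) (algebraMap A (Localization.AtPrime 𝔪) F) = t →
    JOpenBodyLE3 iotaFlatT jFlatT A 𝔪 F

/-- The `(ε, τ) = (1, 1)` point body is vacuous: `ε = 1` forces `τ = 0` at dimension `≤ 3` (res-type-013's
`iotaTau_eq_zero_of_iotaEps_eq_one`). [OURS · seam · (o52-asm)] -/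
theorem pointBodyLE3_one_one (p : ℕ) : PointBodyLE3 p 1 1 := by
  intro k₀ _ _ _ A _ _ _ 𝔪 _ F hreg hdim _ _ _ hε hτ
  exfalso
  have hdim' : ringKrullDim (Localization.AtPrime 𝔪) ≤ 3 := by rw [hdim]; exact le_of_eq (by norm_cast)
  have h0 := iotaTau_eq_zero_of_iotaEps_eq_one hdim' hε
  rw [hτ] at h0
  exact one_ne_zero h0

end JOpenLE3

end Summit.ResolutionOfSingularities.ResolutionOfSingularities.Theorems

end
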